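import Literature.Geometry.Manifold.KondoTanakaLocalDiffeomorph
import Literature.Topology.FourManifolds.NormalRetraction
import HarnessLib

/-!
# Proof of the Kondo–Tanaka recognition theorem (`KondoTanakaRecognition_holds`)

Topic `Geometry/Manifold`; namespace `Literature.Geometry.Manifold`. Discharge of the named fact
`Literature.Geometry.Manifold.KondoTanakaRecognition` (`LipschitzClarkeRegular.lean`; Kondo–Tanaka,
Nonlinear Anal. 155 (2017), Cor. 1.10 of Thm. 1.3): *a bi-Lipschitz homeomorphism `h : M ≃ₜ N` of
compact smooth manifolds such that `h` (and `h⁻¹`) has no Clarke-singular point is replaced by a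
diffeomorphism.* The proof follows the printed one (K–T §2.2–2.3) in the tree's vocabulary:

1. embed `N ⊆ ℝᴷ` by Whitney (Mathlib `exists_embedding_euclidean_of_compact`) and take the
   smooth normal retraction `r` of an open tube `T ⊇ e(N)`
   (`Literature.Topology.FourManifolds.exists_normalRetraction`) — K–T's nearest-point projection
   `π_N`;
2. `F = e ∘ h` is Lipschitz in charts (`exists_lipschitzOnWith_comp_extChartAt_symm`); choose a
   patch system finer than the Lipschitz neighbourhoods (`exists_patchSystem`) and Lipschitz
   extensions `gₚ` of `F ∘ κₚ⁻¹` (Mathlib `LipschitzOnWith.extend_finite_dimension`);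
3. smooth: `F_ε = Σₚ ρₚ • (J_ε gₚ) ∘ κₚ` (`KondoTanakaSmoothing`, K–T Def. 2.15/(2.17)), uniformly
   `C₁ε`-close to `F` (Lemma 2.17), and `f_ε = r ∘ F_ε : M → N` is `C^∞` once `F_ε(M) ⊆ T`;
4. pointwise package (`KondoTanakaLocalDiffeomorph`, K–T Lemmas 2.21–2.25 and Example 1.8): near
   every point, for `ε` small, `f_ε` is a local diffeomorphism and injective on a FIXED
   neighbourhood; by compactness finitely many neighbourhoods and one `ε` suffice;
5. `f_ε` is injective (points with equal images are `λ`-close for `F`, a Lebesgue number of the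
   cover, because `F_ε ≈ F` and `e ∘ r ≈ id` near `e(N)`) and surjective (the continuous injective
   open self-map `h⁻¹ ∘ f_ε` of `M` is onto, `surjective_of_injective_of_isOpenMap` — this replaces
   the covering-space Lemma 2.26 of K–T), hence a diffeomorphism
   (Mathlib `IsLocalDiffeomorph.diffeomorphOfBijective`).

Only the hypotheses on `h` are used (those on `h⁻¹` follow from them by Clarke's inverse function
theorem, and are not needed by the argument). Everything here is proved; no definitions, no
named facts.

## References

* K. Kondo, M. Tanaka, *Approximations of Lipschitz maps via immersions and differentiable exotic
  sphere theorems*, Nonlinear Anal. 155 (2017) 219–249 (arXiv:1408.6036), Thm. 1.3, Cor. 1.10,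
  §2.2–2.3. [KondoTanaka2017]
* F. H. Clarke, *On the inverse function theorem*, Pacific J. Math. 64 (1976). [Clarke1976]
-/

noncomputable section

open scoped Manifold ContDiff Topology NNReal
open Set Function Filter Metric
open Literature.Analysis.Convolution Literature.Topology.FourManifolds

namespace Literature.Geometry.Manifold

/-- **Kondo–Tanaka recognition theorem, working form** (Kondo–Tanaka 2017, Cor. 1.10): a
homeomorphism `h : M ≃ₜ N` between compact Hausdorff `C^∞` manifolds modelled on `ℝⁿ` which is
locally Lipschitz in charts and has no Clarke-singular point in charts is accompanied by a
diffeomorphism `M ≃ₘ N`. [cite: KondoTanaka2017, Corollary 1.10] -/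
theorem nonempty_diffeomorph_of_clarkeRegularInCharts {n : ℕ} {M : Type*} [TopologicalSpace M]
    [T2Space M] [CompactSpace M] [ChartedSpace (EuclideanSpace ℝ (Fin n)) M]
    [IsManifold (𝓡 n) ∞ M] {N : Type*} [TopologicalSpace N] [T2Space N]
    [ChartedSpace (EuclideanSpace ℝ (Fin n)) N] [IsManifold (𝓡 n) ∞ N] (h : M ≃ₜ N)
    (hL : LocallyLipschitzInCharts (𝓡 n) (𝓡 n) h) (hR : ClarkeRegularInCharts (𝓡 n) (𝓡 n) h) :
    Nonempty (M ≃ₘ⟮𝓡 n, 𝓡 n⟯ N) := by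
  classical
  rcases isEmpty_or_nonempty M with hM | hM
  · exact ⟨{ toEquiv := h.toEquiv
             contMDiff_toFun := fun x => (IsEmpty.false x).elim
             contMDiff_invFun := fun y => (IsEmpty.false (h.symm y)).elim }⟩
  haveI : Nonempty N := hM.map h
  haveI : CompactSpace N := h.compactSpace
  -- Step 1: Whitney embedding of `N` and the normal retraction
  obtain ⟨K, e, he, hemb, hinjd⟩ := exists_embedding_euclidean_of_compact (I := 𝓡 n) (M := N)
  obtain ⟨εr, hεr, hTo, hr, hre⟩ := exists_normalRetraction (I := 𝓡 n) he hemb.injective hinjd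
  set T : Set (EuclideanSpace ℝ (Fin K)) := normalTube (𝓡 n) e εr with hT
  set r : EuclideanSpace ℝ (Fin K) → N := normalRetraction (𝓡 n) e εr with hrdef
  have hre0 : ∀ y, e y ∈ T ∧ r (e y) = y := fun y => by
    simpa using hre y 0 (Submodule.zero_mem _) (by simpa using hεr)
  -- Step 2: chart data of `F = e ∘ h`, a fine patch system, Lipschitz extensions
  have hdat : ∀ z : M, ∃ δ > (0 : ℝ), ∃ Lz : ℝ≥0, LipschitzOnWith Lz
      ((e ∘ h) ∘ (extChartAt (𝓡 n) z).symm) (closedBall (extChartAt (𝓡 n) z z) (4 * δ)) := by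
    intro z
    obtain ⟨Lz, s, hs, hlip⟩ :=
      exists_lipschitzOnWith_comp_extChartAt_symm (V := EuclideanSpace ℝ (Fin K)) h.continuous hL he z
    obtain ⟨ρ, hρ, hball⟩ := Metric.mem_nhds_iff.1 hs
    exact ⟨ρ / 8, by positivity, Lz,
      hlip.mono ((closedBall_subset_ball (by linarith)).trans hball)⟩
  choose δ hδ Lz hLz using hdat
  obtain ⟨t, P, hP⟩ := exists_patchSystem (I := 𝓡 n) (M := M)
    (fun _ : M => ContinuousLinearEquiv.refl ℝ (EuclideanSpace ℝ (Fin n))) δ hδ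
  have hlipκ : ∀ p : ↥t, LipschitzOnWith (Lz p * 1) ((e ∘ h) ∘ (P.chart p).inv)
      (closedBall 0 (4 * P.r p)) := by
    intro p
    obtain ⟨hchart, hrle⟩ := hP p
    have heq : (e ∘ h) ∘ (P.chart p).inv =
        ((e ∘ h) ∘ (extChartAt (𝓡 n) (p : M)).symm) ∘ fun y => y + extChartAt (𝓡 n) (p : M) p := by
      funext y
      simp [hchart, FramedChart.centred, FramedChart.inv_apply]
    rw [heq]
    refine (hLz p).comp (IsometryEquiv.addRight _).isometry.lipschitz.lipschitzOnWith
      fun y hy => ?_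
    rw [mem_closedBall, dist_eq_norm, add_sub_cancel_right]
    rw [mem_closedBall, dist_zero_right] at hy
    nlinarith [hy, hrle, P.r_pos p]
  have hext : ∀ p : ↥t, ∃ gp : EuclideanSpace ℝ (Fin n) → EuclideanSpace ℝ (Fin K),
      LipschitzWith (lipschitzExtensionConstant (EuclideanSpace ℝ (Fin K)) * (Lz p * 1)) gp ∧
        EqOn gp ((e ∘ h) ∘ (P.chart p).inv) (ball 0 (3 * P.r p)) := by
    intro p
    obtain ⟨gp, hgpL, hgpeq⟩ := (hlipκ p).extend_finite_dimension
    refine ⟨gp, hgpL, fun y hy => (hgpeq ?_).symm⟩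
    exact (ball_subset_closedBall.trans (closedBall_subset_closedBall
      (by nlinarith [P.r_pos p]))) hy
  choose g hgL hgF using hext
  -- Step 3: the smoothed maps and the uniform closeness
  set Fε : ℝ → M → EuclideanSpace ℝ (Fin K) :=
    fun ε x => ∑ p, P.rho p x • mollify ε (g p) ((P.chart p).map x) with hFε
  set C₁ : ℝ := (∑ p : ↥t, ((lipschitzExtensionConstant (EuclideanSpace ℝ (Fin K)) *
    (Lz (p : M) * 1) : ℝ≥0) : ℝ)) * 2 with hC₁
  have hC₁0 : 0 ≤ C₁ := by positivity
  have hsup : ∀ ε, 0 < ε → ∀ x, ‖Fε ε x - e (h x)‖ ≤ C₁ * ε := fun ε hε x => by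
    have h1 := P.norm_patchSmooth_sub_le (F := e ∘ h) hgL hgF hε x
    calc ‖Fε ε x - e (h x)‖
        ≤ (∑ p : ↥t, ((lipschitzExtensionConstant (EuclideanSpace ℝ (Fin K)) *
            (Lz (p : M) * 1) : ℝ≥0) : ℝ)) * (2 * ε) := h1
      _ = C₁ * ε := by rw [hC₁]; ring
  -- Step 4: pointwise packages, a finite subcover, one `ε`
  have hpkg := fun q₀ : M => P.exists_nhds_isLocalDiffeomorphAt_injOn hL hR
    (e := e) hTo hr hre0 hgL hgF q₀
  choose W hWo hWq ε₀ hε₀ hWp using hpkg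
  obtain ⟨S, -, hScov⟩ := isCompact_univ.elim_nhds_subcover W fun x _ => (hWo x).mem_nhds (hWq x)
  have hcov : ∀ x : M, ∃ s : ↥S, x ∈ W (s : M) := fun x => by
    obtain ⟨i, hi, hx⟩ := mem_iUnion₂.1 (hScov (mem_univ x))
    exact ⟨⟨i, hi⟩, hx⟩
  have hSne : S.Nonempty := by
    obtain ⟨x⟩ := hM
    obtain ⟨s, -⟩ := hcov x
    exact ⟨s, s.2⟩
  set ε₁ : ℝ := S.inf' hSne ε₀ with hε₁
  have hε₁pos : 0 < ε₁ := (Finset.lt_inf'_iff hSne).2 fun s _ => hε₀ s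
  have hε₁le : ∀ s ∈ S, ε₁ ≤ ε₀ s := fun s hs => Finset.inf'_le _ hs
  -- Lebesgue number of the cover with respect to `F = e ∘ h`
  have hFc : Continuous (e ∘ h) := he.continuous.comp h.continuous
  have hFinj : Injective (e ∘ h) := hemb.injective.comp h.injective
  obtain ⟨lam, hlam, hleb⟩ := exists_pos_forall_dist_lt hFc hFinj (W := fun s : ↥S => W (s : M))
    (fun s => hWo s) hcov
  -- uniform smallness of `z - e (r z)` near `e(N)`
  set Θ : EuclideanSpace ℝ (Fin K) → ℝ := fun z => ‖z - e (r z)‖ with hΘ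
  have hΘc : ContinuousOn Θ T :=
    (continuousOn_id.sub (he.continuous.comp_continuousOn hr.continuousOn)).norm
  have hKc : IsCompact (range e) := isCompact_range he.continuous
  have hKT : range e ⊆ T := by rintro _ ⟨y, rfl⟩; exact (hre0 y).1
  have hΘ0 : ∀ z ∈ range e, Θ z = 0 := by rintro _ ⟨y, rfl⟩; simp [hΘ, (hre0 y).2]
  obtain ⟨ϑ, hϑ, hϑT, hϑβ⟩ := exists_cthickening_subset_forall_lt hTo hKc hKT hΘc hΘ0
    (β := lam / 4) (by positivity)
  -- the smoothing parameter
  set m : ℝ := min ϑ (lam / 8) with hm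
  have hm0 : 0 < m := lt_min hϑ (by positivity)
  set ε : ℝ := min (ε₁ / 2) (m / (C₁ + 1)) with hεdef
  have hεpos : 0 < ε := lt_min (by positivity) (by positivity)
  have hεlt : ε < ε₁ := (min_le_left _ _).trans_lt (by linarith)
  have hεsmall : C₁ * ε ≤ m := by
    have h1 : C₁ * ε ≤ C₁ * (m / (C₁ + 1)) := mul_le_mul_of_nonneg_left (min_le_right _ _) hC₁0
    have h2 : C₁ * (m / (C₁ + 1)) ≤ m := by
      rw [mul_div_assoc', div_le_iff₀ (by positivity)]
      nlinarith [hC₁0, hm0]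
    exact h1.trans h2
  have hεI : ∀ s ∈ S, ε ∈ Ioo 0 (ε₀ s) := fun s hs => ⟨hεpos, hεlt.trans_le (hε₁le s hs)⟩
  set f : M → N := r ∘ Fε ε with hf
  -- (1) `F_ε(M)` lies in the `ϑ`-neighbourhood of `e(N)`, inside the tube
  have hFεnear : ∀ x, Fε ε x ∈ cthickening ϑ (range e) := fun x =>
    mem_cthickening_of_dist_le _ (e (h x)) _ _ (mem_range_self _) (by
      rw [dist_eq_norm]
      exact (hsup ε hεpos x).trans (hεsmall.trans (min_le_left _ _)))
  have hFεT : ∀ x, Fε ε x ∈ T := fun x => hϑT (hFεnear x)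
  -- (2) `f` is smooth and a local diffeomorphism
  have hFεs : ContMDiff (𝓡 n) 𝓘(ℝ, EuclideanSpace ℝ (Fin K)) ∞ (Fε ε) :=
    P.contMDiff_patchSmooth g (fun p => (hgL p).continuous) ε
  have hfs : ContMDiff (𝓡 n) (𝓡 n) ∞ f := hr.comp_contMDiff hFεs hFεT
  have hld : IsLocalDiffeomorph (𝓡 n) (𝓡 n) ∞ f := fun x => by
    obtain ⟨s, hxs⟩ := hcov x
    exact (hWp s ε (hεI s s.2)).2.1 x hxs
  -- (3) `f` is injective
  have hinj : Injective f := by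
    intro a b hab
    have hclose : dist ((e ∘ h) a) ((e ∘ h) b) < lam := by
      have h1 : ‖Fε ε a - e (h a)‖ ≤ lam / 8 :=
        (hsup ε hεpos a).trans (hεsmall.trans (min_le_right _ _))
      have h2 : ‖Fε ε b - e (h b)‖ ≤ lam / 8 :=
        (hsup ε hεpos b).trans (hεsmall.trans (min_le_right _ _))
      have h3 : ‖Fε ε a - e (r (Fε ε a))‖ < lam / 4 := hϑβ _ (hFεnear a)
      have h4 : ‖Fε ε b - e (r (Fε ε b))‖ < lam / 4 := hϑβ _ (hFεnear b)
      have h5 : e (r (Fε ε a)) = e (r (Fε ε b)) := congrArg e hab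
      rw [dist_eq_norm]
      simp only [comp_apply]
      have heq : e (h a) - e (h b) = (e (h a) - Fε ε a) + (Fε ε a - e (r (Fε ε a))) +
          (e (r (Fε ε b)) - Fε ε b) + (Fε ε b - e (h b)) := by
        rw [h5]; abel
      rw [heq]
      refine (norm_add_le _ _).trans_lt ?_
      have h6 := norm_add₃_le (a := e (h a) - Fε ε a) (b := Fε ε a - e (r (Fε ε a)))
        (c := e (r (Fε ε b)) - Fε ε b)
      rw [norm_sub_rev (e (h a)), norm_sub_rev (e (r (Fε ε b)))] at h6
      linarith
    obtain ⟨s, has, hbs⟩ := hleb a b hclose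
    exact (hWp s ε (hεI s s.2)).2.2 has hbs hab
  -- (4) `f` is surjective
  have hsurj : Surjective f := by
    haveI : LocallyConnectedSpace M :=
      ChartedSpace.locallyConnectedSpace (EuclideanSpace ℝ (Fin n)) M
    have hg' : Surjective (h.symm ∘ f) :=
      surjective_of_injective_of_isOpenMap (h.symm.continuous.comp hfs.continuous)
        (h.symm.injective.comp hinj) (h.symm.isOpenMap.comp hld.isOpenMap)
    intro y
    obtain ⟨x, hx⟩ := hg' (h.symm y)
    exact ⟨x, h.symm.injective hx⟩
  -- (5) conclusion
  exact ⟨hld.diffeomorphOfBijective ⟨hinj, hsurj⟩⟩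

/-- **Discharge of the named fact `KondoTanakaRecognition`** (Kondo–Tanaka 2017, Cor. 1.10): a
bi-Lipschitz homeomorphism of compact smooth manifolds modelled on `ℝⁿ` with no Clarke-singular
point (for it and its inverse) yields a diffeomorphism. [cite: KondoTanaka2017, Corollary 1.10] -/
theorem KondoTanakaRecognition_holds : KondoTanakaRecognition := by
  intro n M _ _ _ _ _ _ N _ _ _ _ _ h hL _ hR _
  exact nonempty_diffeomorph_of_clarkeRegularInCharts h hL hR

end Literature.Geometry.Manifold

end
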